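import Summits.AtomisticToContinuum.BoseEinsteinCondensation.Theorems.BECThomsonPrincipleGDTransferSeededSpectralDefs
import Summits.AtomisticToContinuum.BoseEinsteinCondensation.Theorems.BECThomsonPrincipleGDTransferSeededPointwiseCatExclusion

/-!
# Route `BECThomsonPrinciple`, crux `GDTransfer` (stmt-AtomisticToContinuum-9482), line `seeded-continuity` —
# spectral seed programme: A BALANCED CAT FORCES A SMALL KY FAN GAP (registered sub-goal `catKyFan`)

Supports (does not close) stmt-AtomisticToContinuum-9482.

**Statement** (`catKyFan : CatKyFan`, the lead's sub-goal of the spectral seed programme typed in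
`…SeededSpectralDefs`): given the smooth block algebra `SmoothBlockAlgebra` (hypothesis), if the two smooth
blocks `f = χ_lo(n̂₀/N)Ψ`, `g = χ_hi(n̂₀/N)Ψ` of a periodic trial state `Ψ` have finite energy forms with
`𝓔(f) + 𝓔(g) ≤ E₀ + Δ` while both sides of the `n̂₀`-law carry mass `≥ τ` (`0 < τ ≤ 1/2`), then
`kyFanTwo ≤ 2E₀ + (8/τ²)Δ`.

**Proof** (Gram–Schmidt + the variational definition of `kyFanTwo`; finite-dimensional bookkeeping over the
reals `p = ‖f‖²`, `q = ‖g‖²`, `s = ⟨f, g⟩`, `ε_f = 𝓔(f) − E₀p ≥ 0`, `ε_g = 𝓔(g) − E₀q ≥ 0`, `ε_f + ε_g ≤ Δ`).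
By the block algebra `p = Σ_S χ_lo² w_S ≥ Σ_{|S| < θN} w_S ≥ τ` (the low cut is `1` below the band) and, for
every real `λ`, `‖g − λf‖² = Σ_S (χ_hi − λχ_lo)² w_S ≥ Σ_{|S| ≥ (1−β)N} w_S ≥ τ` (the cuts are `0`/`1` above
the band).  With `λ = s/p` the pair `e₁ = f/‖f‖`, `e₂ = (g − λf)/‖g − λf‖` (`PeriodicTrialState.ofFun`) is
orthonormal, so `kyFanTwo ≤ E(e₁) + E(e₂)`.  Now `E(e₁) = E₀ + ε_f/p ≤ E₀ + ε_f/τ`; expanding the forms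
along the line (`eform_line_toReal`, `mass_line_toReal`) and using Cauchy–Schwarz for the excess form
(`cross_sq_le`: `|B| ≤ √(ε_fε_g)` for `B = Re t(f,g) + Re 𝓥(f,g) − E₀s`) gives
`𝓔(g − λf) − E₀‖g − λf‖² = ε_g − 2λB + λ²ε_f ≤ 2ε_g + 2λ²ε_f` with `λ²τ ≤ λ²p = q − ‖g − λf‖² ≤ 1`, whence
`E(e₂) ≤ E₀ + (2ε_g + 2ε_f/τ)/τ` and `E(e₁) + E(e₂) ≤ 2E₀ + 3Δ/τ² ≤ 2E₀ + 8Δ/τ²`.  All [folklore]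
bookkeeping over landed tree lemmas; no new definitions.

References: ReedSimonIV1978 Thm XIII.1–2 (min-max, Ky Fan) — background only.
-/

noncomputable section

open MeasureTheory Filter
open scoped ENNReal NNReal ComplexConjugate

namespace Summit.AtomisticToContinuum.BoseEinsteinCondensation.Cruxes.GDTransfer.Seeded

open Literature.MathematicalPhysics.QuantumManyBody
open Literature.MathematicalPhysics.QuantumManyBody.BoseGas
open Summit.AtomisticToContinuum.BoseEinsteinCondensation.Theses.BECThomsonPrinciple
open Summit.AtomisticToContinuum.BoseEinsteinCondensation.Theorems.GaussianDominationCan.Negative (modeProj)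
open Summit.AtomisticToContinuum.BoseEinsteinCondensation.Cruxes.GDTransfer.DysonDressedWitness
  (IsDirection mass eform eform_trialState)
open Summit.AtomisticToContinuum.BoseEinsteinCondensation.Cruxes.GDTransfer.DysonDressedWitness.ChordVariation
  (mass_ne_top_of_continuous continuous_modeProj dir_add dir_const_mul e0_mul_mass_le_eform_toReal)

namespace CatKyFanGS

/-! ## Finite-dimensional bookkeeping -/

/-- A plateau where the profile is `1` bounds the weighted sum from below:
`Σ_{i : P i} w_i ≤ Σ_i a_i² w_i` if `a = 1` on `P` and `w ≥ 0`. [folklore] -/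
theorem sum_filter_le_sq_sum {ι : Type*} [Fintype ι] {P : ι → Prop} [DecidablePred P] {a w : ι → ℝ}
    (hw : ∀ i, 0 ≤ w i) (ha : ∀ i, P i → a i = 1) :
    ∑ i ∈ Finset.univ.filter P, w i ≤ ∑ i, a i ^ 2 * w i := by
  calc ∑ i ∈ Finset.univ.filter P, w i = ∑ i ∈ Finset.univ.filter P, a i ^ 2 * w i :=
        Finset.sum_congr rfl fun i hi => by rw [ha i (Finset.mem_filter.1 hi).2, one_pow, one_mul]
    _ ≤ ∑ i, a i ^ 2 * w i := Finset.sum_le_univ_sum_of_nonneg fun i => mul_nonneg (sq_nonneg _) (hw i)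

/-- The Gram form along a line is a sum of squares, bounded below by the plateau where `a = 0`, `b = 1`:
`Σ_{i : P i} w_i ≤ Σ b²w − 2λ Σ abw + λ² Σ a²w = Σ (b − λa)² w`. [folklore] -/
theorem sum_filter_le_line {ι : Type*} [Fintype ι] {P : ι → Prop} [DecidablePred P] {a b w : ι → ℝ}
    (hw : ∀ i, 0 ≤ w i) (hab : ∀ i, P i → a i = 0 ∧ b i = 1) (l : ℝ) :
    ∑ i ∈ Finset.univ.filter P, w i ≤
      (∑ i, b i ^ 2 * w i) + 2 * (-l) * (∑ i, a i * b i * w i) + (-l) ^ 2 * (∑ i, a i ^ 2 * w i) := by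
  have hq : (∑ i, b i ^ 2 * w i) + 2 * (-l) * (∑ i, a i * b i * w i) + (-l) ^ 2 * (∑ i, a i ^ 2 * w i) =
      ∑ i, (b i - l * a i) ^ 2 * w i := by
    rw [Finset.mul_sum, Finset.mul_sum, ← Finset.sum_add_distrib, ← Finset.sum_add_distrib]
    exact Finset.sum_congr rfl fun i _ => by ring
  rw [hq]
  calc ∑ i ∈ Finset.univ.filter P, w i = ∑ i ∈ Finset.univ.filter P, (b i - l * a i) ^ 2 * w i :=
        Finset.sum_congr rfl fun i hi => by
          obtain ⟨ha, hb⟩ := hab i (Finset.mem_filter.1 hi).2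
          rw [ha, hb]; ring
    _ ≤ _ := Finset.sum_le_univ_sum_of_nonneg fun i => mul_nonneg (sq_nonneg _) (hw i)

/-- **The real bookkeeping of the Gram–Schmidt pair**: with `p + q = 1`, `τ ≤ p`, `τ ≤ μ = ‖g − λf‖²`
(`λp = s`), `E₀p ≤ 𝓔(f)`, `E₀q ≤ 𝓔(g)`, `𝓔(f) + 𝓔(g) ≤ E₀ + Δ`, the line expansion of `𝓔(g − λf)` and
Cauchy–Schwarz for the excess form, the two Rayleigh quotients sum to `≤ 2E₀ + 8Δ/τ²`. [folklore] -/
theorem real_bound {τ p q s l e₀ ef eg T μ eh d : ℝ} (hτ0 : 0 < τ) (hτ1 : τ ≤ 1 / 2)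
    (hpq : p + q = 1) (hτp : τ ≤ p) (hτμ : τ ≤ μ) (hl : l * p = s)
    (hμ : μ = q + 2 * (-l) * s + (-l) ^ 2 * p)
    (hef : e₀ * p ≤ ef) (heg : e₀ * q ≤ eg) (hsum : ef + eg ≤ e₀ + d)
    (heh : eh = eg + 2 * (-l) * T + (-l) ^ 2 * ef)
    (hcs : (T - e₀ * s) ^ 2 ≤ (ef - e₀ * p) * (eg - e₀ * q)) :
    ef / p + eh / μ ≤ 2 * e₀ + 8 / τ ^ 2 * d := by
  have hp0 : 0 < p := hτ0.trans_le hτp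
  have hμ0 : 0 < μ := hτ0.trans_le hτμ
  have hτ1' : τ ≤ 1 := hτ1.trans (by norm_num)
  set εf := ef - e₀ * p with hεf_def
  set εg := eg - e₀ * q with hεg_def
  set B := T - e₀ * s with hB_def
  have hεf : 0 ≤ εf := by rw [hεf_def]; linarith
  have hεg : 0 ≤ εg := by rw [hεg_def]; linarith
  have hd : εf + εg ≤ d := by
    have : e₀ * p + e₀ * q = e₀ := by rw [← mul_add, hpq, mul_one]
    rw [hεf_def, hεg_def]; linarith
  -- `λ²τ ≤ 1`: `λ²p = q − μ ≤ q ≤ 1` and `p ≥ τ`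
  have hl2 : l ^ 2 * τ ≤ 1 := by
    have h1 : l ^ 2 * p = q - μ := by rw [hμ, ← hl]; ring
    nlinarith [sq_nonneg l]
  -- Cauchy–Schwarz for the excess form ⇒ `−2λB ≤ ε_g + λ²ε_f`
  have key : 0 ≤ εg + 2 * l * B + l ^ 2 * εf := by
    rcases hεf.eq_or_lt with h0 | hpos
    · have hB2 : B ^ 2 = 0 := le_antisymm (by rw [← h0, zero_mul] at hcs; exact hcs) (sq_nonneg B)
      rw [pow_eq_zero_iff two_ne_zero] at hB2
      rw [hB2, ← h0]; linarith
    · nlinarith [sq_nonneg (B + l * εf)]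
  -- the two Rayleigh quotients
  have h1 : ef / p = e₀ + εf / p := by rw [hεf_def]; field_simp; ring
  have h2 : eh / μ = e₀ + (εg - 2 * l * B + l ^ 2 * εf) / μ := by
    have : eh = e₀ * μ + (εg - 2 * l * B + l ^ 2 * εf) := by
      rw [heh, hμ, hεf_def, hεg_def, hB_def]; ring
    rw [this]; field_simp
  have h3 : εf / p ≤ εf / τ := div_le_div_of_nonneg_left hεf hτ0 hτp
  have hl3 : l ^ 2 * εf ≤ εf / τ := by rw [le_div_iff₀ hτ0]; nlinarith
  have h4 : (εg - 2 * l * B + l ^ 2 * εf) / μ ≤ (2 * εg + 2 * (εf / τ)) / τ := by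
    have hnum : εg - 2 * l * B + l ^ 2 * εf ≤ 2 * εg + 2 * (εf / τ) := by linarith
    have hnn : 0 ≤ 2 * εg + 2 * (εf / τ) := by positivity
    exact (div_le_div_of_nonneg_right hnum hμ0.le).trans (div_le_div_of_nonneg_left hnn hτ0 hτμ)
  have h5 : εf / τ + (2 * εg + 2 * (εf / τ)) / τ ≤ 8 / τ ^ 2 * d := by
    rw [← add_div, sq, show 8 / (τ * τ) * d = (8 * (d / τ)) / τ by field_simp]
    refine div_le_div_of_nonneg_right ?_ hτ0.le
    have hdτ : d ≤ d / τ := by rw [le_div_iff₀ hτ0]; nlinarith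
    have hfτ : εf / τ ≤ d / τ := div_le_div_of_nonneg_right (by linarith) hτ0.le
    linarith
  rw [h1, h2]
  linarith

end CatKyFanGS

open CatKyFanGS in
/-- **Registered sub-goal `catKyFan` of the spectral seed programme** (line `seeded-continuity`, crux
`GDTransfer`, stmt-AtomisticToContinuum-9482): a balanced near-minimiser forces `kyFanTwo ≤ 2E₀ + (8/τ²)Δ` —
Gram–Schmidt on the two smooth blocks and the variational definition of `kyFanTwo`. [folklore] -/
theorem catKyFan : CatKyFan := by
  intro hB v hv m L hL hE₀ θ β hθ hβ hθβ τ hτ0 hτ Ψ Δ hfe hge hsum hlo hhi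
  -- trivial when `Δ = ⊤`
  rcases eq_or_ne Δ ⊤ with hΔ | hΔ
  · rw [hΔ, ENNReal.mul_top (ENNReal.ofReal_pos.2 (by positivity)).ne', add_top]
    exact le_top
  obtain ⟨hfdir, hgdir, hmass1, hp, hq, hs⟩ := hB m L hL θ β hθ hβ hθβ Ψ
  set f := smoothBlock m L (cutLo θ β) Ψ.ψ with hf_def
  set g := smoothBlock m L (cutHi θ β) Ψ.ψ with hg_def
  set E₀ := periodicGroundStateEnergy v (m + 1) L with hE₀_def
  have hgap : 0 < 1 - β - θ := by linarith
  have hN : (0 : ℝ) < (m : ℝ) + 1 := by positivity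
  have hfc : Continuous f := hfdir.contDiff.continuous
  have hgc : Continuous g := hgdir.contDiff.continuous
  have hmf_top : mass L f ≠ ⊤ := mass_ne_top_of_continuous hfc
  have hmg_top : mass L g ≠ ⊤ := mass_ne_top_of_continuous hgc
  have hcm_top : ∀ S : Finset (Fin (m + 1)), compMass m L S Ψ.ψ ≠ ⊤ := fun S =>
    (mass_ne_top_of_continuous (L := L) (continuous_modeProj S Ψ.contDiff.continuous) :
      mass L (modeProj (m + 1) L S Ψ.ψ) ≠ ⊤)
  -- the real numbers of the bookkeeping
  set p := (mass L f).toReal with hp_def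
  set q := (mass L g).toReal with hq_def
  set s : ℝ := ∑ S : Finset (Fin (m + 1)), cutLo θ β ((S.card : ℝ) / ((m : ℝ) + 1)) *
    cutHi θ β ((S.card : ℝ) / ((m : ℝ) + 1)) * (compMass m L S Ψ.ψ).toReal with hs_def
  have hsre : (∫ X in cellN (m + 1) L, conj (f X) * g X).re = s := by rw [hs, Complex.ofReal_re]
  have hpq : p + q = 1 := by
    rw [hp_def, hq_def, ← ENNReal.toReal_add hmf_top hmg_top, hmass1, ENNReal.toReal_one]
  -- `τ ≤ p` (the low cut is `1` on `{n̂₀ < θN}`)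
  have hτp : τ ≤ p := by
    have hlo_top : loMass m L θ Ψ.ψ ≠ ⊤ := by
      unfold loMass lawMass; exact ENNReal.sum_ne_top.2 fun S _ => hcm_top S
    have h1 := (ENNReal.ofReal_le_iff_le_toReal hlo_top).1 hlo
    unfold loMass lawMass at h1
    rw [ENNReal.toReal_sum fun S _ => hcm_top S] at h1
    refine h1.trans (le_of_le_of_eq
      (sum_filter_le_sq_sum (fun _ => ENNReal.toReal_nonneg) fun S hS => ?_) hp.symm)
    exact cutLo_of_le hgap ((div_le_iff₀ hN).2 (le_of_lt hS))
  have hp0 : 0 < p := hτ0.trans_le hτp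
  have hmf0 : mass L f ≠ 0 := fun h0 => by
    rw [hp_def, h0, ENNReal.toReal_zero] at hp0; exact lt_irrefl _ hp0
  -- the Gram–Schmidt direction `k = g − λf`, `λ = s/p`
  set l : ℝ := s / p with hl_def
  have hl : l * p = s := by rw [hl_def, div_mul_cancel₀ _ hp0.ne']
  set k : Config (m + 1) → ℂ := fun X => g X + ((-l : ℝ) : ℂ) * f X with hk_def
  have hkdir : IsDirection m L k := dir_add hgdir (dir_const_mul hfdir _)
  have hke : eform v L k ≠ ⊤ := PlainCost.eform_line_ne_top hv hfdir.contDiff hgdir.contDiff hfe hge _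
  have hmk_top : mass L k ≠ ⊤ := mass_ne_top_of_continuous hkdir.contDiff.continuous
  set μ := (mass L k).toReal with hμ_def
  have hμ : μ = q + 2 * (-l) * s + (-l) ^ 2 * p := by
    rw [hμ_def, hk_def, PlainCost.mass_line_toReal hfc hgc (-l), hsre]
  -- `τ ≤ μ` (the cuts are `0`/`1` on `{n̂₀ ≥ (1−β)N}`)
  have hτμ : τ ≤ μ := by
    have hhi_top : hiMass m L β Ψ.ψ ≠ ⊤ := by
      unfold hiMass lawMass; exact ENNReal.sum_ne_top.2 fun S _ => hcm_top S
    have h1 := (ENNReal.ofReal_le_iff_le_toReal hhi_top).1 hhi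
    unfold hiMass lawMass at h1
    rw [ENNReal.toReal_sum fun S _ => hcm_top S] at h1
    rw [hμ, hp, hq, hs_def]
    refine h1.trans (sum_filter_le_line (fun _ => ENNReal.toReal_nonneg) (fun S hS => ?_) l)
    have hx : 1 - β ≤ (S.card : ℝ) / ((m : ℝ) + 1) := (le_div_iff₀ hN).2 hS
    exact ⟨cutLo_of_ge hgap hx, cutHi_of_ge hgap hx⟩
  have hμ0 : 0 < μ := hτ0.trans_le hτμ
  have hmk0 : mass L k ≠ 0 := fun h0 => by
    rw [hμ_def, h0, ENNReal.toReal_zero] at hμ0; exact lt_irrefl _ hμ0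
  -- the orthonormal pair
  set e₁ := PeriodicTrialState.ofFun f hfdir.contDiff hfdir.periodic hfdir.symm hmf0 hmf_top with he₁
  set e₂ := PeriodicTrialState.ofFun k hkdir.contDiff hkdir.periodic hkdir.symm hmk0 hmk_top with he₂
  have hff : (∫ X in cellN (m + 1) L, conj (f X) * f X) = (p : ℂ) := by
    rw [hp_def, PlainCost.mass_toReal_eq L hfc, DysonDressedWitness.Lnss.integral_conj_mul_self, Complex.ofReal_re]
  have horth : (∫ X in cellN (m + 1) L, conj (e₁.ψ X) * e₂.ψ X) = 0 := by
    set c₁ : ℂ := ((Real.sqrt (mass L f).toReal)⁻¹ : ℂ) with hc₁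
    set c₂ : ℂ := ((Real.sqrt (mass L k).toReal)⁻¹ : ℂ) with hc₂
    have h1 : e₁.ψ = fun X => c₁ * f X := rfl
    have h2 : e₂.ψ = fun X => c₂ * k X := rfl
    have h3 : (fun X => conj (c₁ * f X) * (c₂ * k X)) =
        fun X => (conj c₁ * c₂) * (conj (f X) * g X + ((-l : ℝ) : ℂ) * (conj (f X) * f X)) := by
      funext X; simp only [hk_def, map_mul]; ring
    rw [h1, h2, h3, integral_const_mul, integral_add (PlainCost.integrable_inner hfc hgc)
      ((PlainCost.integrable_inner hfc hfc).const_mul _), integral_const_mul, hs, hff,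
      ← Complex.ofReal_mul, ← Complex.ofReal_add]
    have h4 : s + -l * p = 0 := by rw [← hl]; ring
    rw [h4, Complex.ofReal_zero, mul_zero]
  -- energies of the pair, in real numbers
  have hE1 : periodicEnergy v e₁ = ENNReal.ofReal ((eform v L f).toReal / p) := by
    rw [he₁, periodicEnergy_ofFun v hfdir hmf0 hmf_top,
      ← ENNReal.ofReal_toReal (ENNReal.mul_ne_top (ENNReal.inv_ne_top.2 hmf0) hfe), ENNReal.toReal_mul,
      ENNReal.toReal_inv, inv_mul_eq_div]
  have hE2 : periodicEnergy v e₂ = ENNReal.ofReal ((eform v L k).toReal / μ) := by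
    rw [he₂, periodicEnergy_ofFun v hkdir hmk0 hmk_top,
      ← ENNReal.ofReal_toReal (ENNReal.mul_ne_top (ENNReal.inv_ne_top.2 hmk0) hke), ENNReal.toReal_mul,
      ENNReal.toReal_inv, inv_mul_eq_div]
  -- the real bookkeeping
  have hsum' : (eform v L f).toReal + (eform v L g).toReal ≤ E₀.toReal + Δ.toReal := by
    rw [← ENNReal.toReal_add hfe hge, ← ENNReal.toReal_add hE₀ hΔ]
    exact ENNReal.toReal_mono (ENNReal.add_ne_top.2 ⟨hE₀, hΔ⟩) hsum
  have hcs := PlainCost.cross_sq_le hv hfdir hgdir hfe hge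
  rw [hsre] at hcs
  have hreal := real_bound hτ0 hτ hpq hτp hτμ hl hμ (e0_mul_mass_le_eform_toReal v hfdir hfe)
    (e0_mul_mass_le_eform_toReal v hgdir hge) hsum'
    (PlainCost.eform_line_toReal hv hfdir.contDiff hgdir.contDiff hfe hge (-l)) hcs
  -- assembly
  have hx1 : 0 ≤ (eform v L f).toReal / p := by positivity
  have hx2 : 0 ≤ (eform v L k).toReal / μ := by positivity
  calc kyFanTwo v (m + 1) L ≤ periodicEnergy v e₁ + periodicEnergy v e₂ :=
        iInf_le_of_le e₁ (iInf_le_of_le e₂ (iInf_le_of_le horth le_rfl))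
    _ = ENNReal.ofReal ((eform v L f).toReal / p + (eform v L k).toReal / μ) := by
        rw [hE1, hE2, ENNReal.ofReal_add hx1 hx2]
    _ ≤ ENNReal.ofReal (2 * E₀.toReal + 8 / τ ^ 2 * Δ.toReal) := ENNReal.ofReal_le_ofReal hreal
    _ = 2 * E₀ + ENNReal.ofReal (8 / τ ^ 2) * Δ := by
        rw [ENNReal.ofReal_add (by positivity) (by positivity),
          ENNReal.ofReal_mul (by norm_num : (0 : ℝ) ≤ 2), ENNReal.ofReal_ofNat, ENNReal.ofReal_toReal hE₀,
          ENNReal.ofReal_mul (by positivity), ENNReal.ofReal_toReal hΔ]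

end Summit.AtomisticToContinuum.BoseEinsteinCondensation.Cruxes.GDTransfer.Seeded

end
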